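import Summits.CriticalPhenomena.CardyFormulaZ2.Theses.DyadicBetaRigidity
import Summits.CriticalPhenomena.CardyFormulaZ2.Theorems.DyadicBetaRigidityDyadicBetaSufficesBeta
import Literature.Probability.RandomPlanarGeometry.ConformalRectangleProofs

/-!
# The crux implies the hard stub S1 of line `Sketch`: the line is tight modulo rigidity

Crux `DyadicLatticeBetaLaw` (stmt-CriticalPhenomena-18183, route `DyadicBetaRigidity` of
`CardyFormulaZ2`), line `Sketch` (idea `equimodular-comparison`, skeleton
`Cruxes/DyadicLatticeBetaLaw/Lines/Sketch.lean`). The line's composition proves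
`S1 → S2 → S5a → S5b → CardyRigiditySeq → DyadicLatticeBetaLaw` with S2, S5a, S5b landed
(Theorems/DyadicBetaRigidityDyadicLatticeBetaLawStub*.lean), so the crux is reduced to
`S1 ∧ CardyRigiditySeq`. This file records the converse direction `DyadicLatticeBetaLaw → S1`
(registered support stub `stub_equicontinuousComparison_of_crux`): the dyadic beta law of the crux
gives, for any two lattice polygons, convergence along the dyadic ladders to `I_a` of their moduli,
and `I_a` is uniformly continuous on `[0, 1]` (tree: `DyadicLattice.continuousOn_incBeta`). Hence,
modulo the external sequential rigidity item (stmt-CriticalPhenomena-4680), S1 is EXACTLY as strong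
as the crux: `S1 ⇒ crux` needs rigidity, `crux ⇒ S1` needs nothing.

References: B. Bollobás, O. Riordan, *Percolation* (2006), Ch. 7 §7.1 (the beta law `I_{2/3}` is
Cardy's function); J. Cardy, J. Phys. A 25 (1992) L201, eq. (8).
-/

noncomputable section

open MeasureTheory Filter Set Metric Topology
open UpperHalfPlane (upperHalfPlaneSet)
open Literature.Probability.RandomPlanarGeometry Literature.Probability.LatticeModels
open Literature.Probability.Percolation

namespace Summit.CriticalPhenomena.CardyFormulaZ2.Cruxes.DyadicLatticeBetaLaw.Stubs

/-- **`DyadicLatticeBetaLaw → S1`** (registered support stub `stub_equicontinuousComparison_of_crux`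
of crux stmt-CriticalPhenomena-18183, line `Sketch`). If every lattice polygon of every mesh `h` has
bond-`ℤ²` crossing probabilities converging along `h/2^k` to `I_a` of its modulus (the crux), then
for every `ε > 0` and `η ∈ (0,1)` there is `θ > 0` such that two lattice polygons whose moduli are
`θ`-close to `η` have crossing probabilities along their dyadic ladders eventually `ε`-close (stub
S1 `stub_equicontinuousComparison` verbatim): uniform continuity of `I_a` on `[0, 1]`.
[cite: BollobasRiordan2006, Ch. 7 §7.1] -/
theorem stub_equicontinuousComparison_of_crux :
    Summit.CriticalPhenomena.CardyFormulaZ2.Theses.DyadicBetaRigidity.DyadicLatticeBetaLaw →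
    ∀ ε : ℝ, 0 < ε → ∀ η ∈ Set.Ioo (0 : ℝ) 1, ∃ θ : ℝ, 0 < θ ∧
      ∀ h h' : ℝ, 0 < h → 0 < h' → ∀ R R' : ConformalRectangle,
        (∃ S : Finset (ℂ × ℂ), (∀ p ∈ S, ∃ u v : Site 2, (zdGraph 2).Adj u v ∧
            p.1 = meshPoint h u ∧ p.2 = meshPoint h v) ∧
            frontier R.carrier ⊆ ⋃ p ∈ S, segment ℝ p.1 p.2) →
        (∃ S : Finset (ℂ × ℂ), (∀ p ∈ S, ∃ u v : Site 2, (zdGraph 2).Adj u v ∧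
            p.1 = meshPoint h' u ∧ p.2 = meshPoint h' v) ∧
            frontier R'.carrier ⊆ ⋃ p ∈ S, segment ℝ p.1 p.2) →
        ∀ (φ : ConformalEquiv upperHalfPlaneSet R.carrier) (x : Fin 4 → ℝ)
          (φ' : ConformalEquiv upperHalfPlaneSet R'.carrier) (x' : Fin 4 → ℝ),
          R.IsUniformizing φ x → R'.IsUniformizing φ' x' →
          |crossRatio x - η| < θ → |crossRatio x' - η| < θ →
          ∀ᶠ k : ℕ in atTop,
            |bondDomainCrossingProb R (h / 2 ^ k) - bondDomainCrossingProb R' (h' / 2 ^ k)| < ε := by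
  rintro ⟨a, ha, hD⟩ ε hε η _
  -- the law `I_a` is uniformly continuous on `[0, 1]`
  set I : ℝ → ℝ := fun u ↦ (∫ s in (0 : ℝ)..u, (s * (1 - s)) ^ (-a)) /
    ∫ s in (0 : ℝ)..1, (s * (1 - s)) ^ (-a) with hI
  have hIc : ContinuousOn I (Icc 0 1) :=
    (Summit.CriticalPhenomena.CardyFormulaZ2.Theorems.DyadicLattice.continuousOn_incBeta ha.2).div_const _
  obtain ⟨θ, hθ, hU⟩ := Metric.uniformContinuousOn_iff.1
    (isCompact_Icc.uniformContinuousOn_of_continuous hIc) (ε / 2) (half_pos hε)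
  refine ⟨θ / 2, half_pos hθ, ?_⟩
  intro h h' hh hh' R R' hR hR' φ x φ' x' hφ hφ' hx hx'
  have hηR := ConformalRectangle.crossRatio_mem_Ioo_of_isUniformizing hφ
  have hηR' := ConformalRectangle.crossRatio_mem_Ioo_of_isUniformizing hφ'
  -- the two moduli are `θ`-close, so their `I_a`-values are `ε/2`-close
  have hF : dist (I (crossRatio x)) (I (crossRatio x')) < ε / 2 := by
    refine hU _ (Ioo_subset_Icc_self hηR) _ (Ioo_subset_Icc_self hηR') ?_
    rw [Real.dist_eq]
    calc |crossRatio x - crossRatio x'| = |(crossRatio x - η) - (crossRatio x' - η)| := by ring_nf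
      _ ≤ |crossRatio x - η| + |crossRatio x' - η| := abs_sub _ _
      _ < θ := by linarith
  -- the two dyadic ladders converge to these values
  have hT := Metric.tendsto_nhds.1 (hD h hh R hR φ x hφ) (ε / 4) (by positivity)
  have hT' := Metric.tendsto_nhds.1 (hD h' hh' R' hR' φ' x' hφ') (ε / 4) (by positivity)
  filter_upwards [hT, hT'] with k hk hk'
  rw [Real.dist_eq] at hk hk' hF
  have e1 := abs_lt.1 hk
  have e2 := abs_lt.1 hk'
  have e3 := abs_lt.1 hF
  rw [abs_lt]
  constructor <;> linarith [e1.1, e1.2, e2.1, e2.2, e3.1, e3.2]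

end Summit.CriticalPhenomena.CardyFormulaZ2.Cruxes.DyadicLatticeBetaLaw.Stubs

end
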